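import Summits.BirchSwinnertonDyer.BirchSwinnertonDyer.Theorems.Rank2ObservatoryKernelAnnihilator2
import HarnessLib

/-!
# BirchSwinnertonDyer — rank ≥ 2 observatory: the kernel-certificate WALKER (one Boolean check, one soundness theorem)

HONEST FRAMING: per-curve certified theorems and census instruments; no claim on BSD in rank ≥ 2.

Up to now every census row with a kernel certificate got its own theorem
`two_le_rank : 2 ≤ rank_ℤ E(ℚ)` (files `Rank2ObservatoryKernelCerts*`), assembled from the
per-certificate-shape theorems `two_le_mordellWeilRank_of_ratCert / _of_ratCert₂ / _of_ratCert₄`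
(and their integral-point special cases `_of_kernelCert / _of_kernelCert₂`) with every hypothesis
discharged by its own `decide +kernel`. This file REFLECTS those assembly theorems into ONE Boolean
function on certificate DATA:

* `RatCert` — the data of a certificate: the affine coordinates `(x₁,y₁), (x₂,y₂)` of two rational
  points and `(x₃,y₃)` of their sum, the kernel-count killers `S = [(ℓ, #Ẽ(𝔽_ℓ)), …]`, the torsion
  annihilator `t`, three witness primes `q₁ q₂ q₃` and the residues `(mᵢ, nᵢ) ≡ (xᵢ, yᵢ) mod qᵢ`;
* `Cert` — the three certificate shapes: `odd` (`t` odd, doubling witnesses `xDoubleFree`),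
  `two` (`t ≡ 2 mod 4`, coset witnesses `xCosetFree`), `four c e m q₀` (`t = 2^e·m`, `m` odd, and a
  good odd prime `q₀` with no element of order `4` in `Ẽ(𝔽_{q₀})`, `noOrder4`; coset witnesses);
* `Cert.check V c : Bool` — the conjunction of exactly the hypotheses of the corresponding assembly
  theorem, each as a Boolean (`onCurveQ`, `ratChord`, `killerB` = good prime + `zmodPointCount`,
  `annihilatorCheck`, `residueB`, `dblWitnessB` / `cosWitnessB` / `noOrder4B`; primality by Mathlib's
  kernel-friendly `Nat.decidablePrime`);
* **`two_le_mordellWeilRank_of_certCheck : c.check V = true → 2 ≤ rank_ℤ E_V(ℚ)`** — soundness,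
  a case split into the three existing assembly theorems (no new mathematics);
* `certRowCheck : Rank2Row × Cert → Bool` and **`two_le_mordellWeilRank_of_all_certRowCheck`**:
  if `L.all certRowCheck = true` for a list `L` of (census row, certificate) pairs then EVERY row of
  `L.map Prod.fst` has `2 ≤ rank_ℤ E(ℚ)` — so a data file proves hundreds of rows with ONE
  `decide +kernel` per segment (`Rank2ObservatoryKernelWalk*` files), replacing one proposal per
  eight curves by one per several hundred. The per-row content is identical to the per-curve files
  (same checks, same kernel evaluation, axioms `propext`, `Classical.choice`, `Quot.sound`).

References: Cremona, *Algorithms for Modular Elliptic Curves* (1997) §2.4, §3.5, Table 1;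
Silverman, *The Arithmetic of Elliptic Curves* (2009) III.2.3, VII.3.1(b), VII.3.4, VIII.6.7.
-/

-- single-conjunct summit: `Summit.BirchSwinnertonDyer.BirchSwinnertonDyer.…` repeats the name by design
set_option linter.dupNamespace false

namespace Summit.BirchSwinnertonDyer.BirchSwinnertonDyer.Rank2Observatory

open WeierstrassCurve

section Checks

variable (V : WeierstrassCurve ℤ)

/-- `(x, y) ∈ ℚ²` satisfies the Weierstrass equation of `V` (Boolean). [cite: SilvermanAEC2009, III.1] -/
def onCurveQ (x y : ℚ) : Bool :=
  decide (y ^ 2 + (V.a₁ : ℚ) * x * y + (V.a₃ : ℚ) * y =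
    x ^ 3 + (V.a₂ : ℚ) * x ^ 2 + (V.a₄ : ℚ) * x + (V.a₆ : ℚ))

/-- `onCurveQ` is sound: the pair satisfies the equation. [cite: SilvermanAEC2009, III.1] -/
theorem onCurveQ_spec {x y : ℚ} (h : onCurveQ V x y = true) :
    y ^ 2 + (V.a₁ : ℚ) * x * y + (V.a₃ : ℚ) * y =
      x ^ 3 + (V.a₂ : ℚ) * x ^ 2 + (V.a₄ : ℚ) * x + (V.a₆ : ℚ) :=
  of_decide_eq_true h

/-- Good prime (Boolean): `q` prime — Mathlib's kernel-friendly `Nat.decidablePrime` — and `q ∤ Δ(V)`.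
[cite: SilvermanAEC2009, VII.3.1(b)] -/
def goodPrimeB (q : ℕ) : Bool :=
  decide q.Prime && decide (¬ (q : ℤ) ∣ V.Δ)

/-- One kernel-count killer `(ℓ, N)` (Boolean): `ℓ` a good prime and `#Ẽ(𝔽_ℓ) = N` (`zmodPointCount`).
[cite: CremonaAlgorithms1997, §2.4] -/
def killerB : ℕ × ℕ → Bool
  | (0, _) => false
  | (ℓ + 1, N) => goodPrimeB V (ℓ + 1) && (zmodPointCount V (ℓ + 1) == N)

/-- Soundness of the killer list: the hypothesis `hS` of the assembly theorems.
[cite: SilvermanAEC2009, VII.3.1(b)] -/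
theorem killers_of_all_killerB {S : List (ℕ × ℕ)} (h : S.all (killerB V) = true) :
    ∀ ℓN ∈ S, ℓN.1.Prime ∧
      ∀ (x : (V.map (Int.castRingHom ℚ)).toAffine.Point) (n : ℕ), ¬ ℓN.1 ∣ n → n • x = 0 →
        ℓN.2 • x = 0 := by
  induction S with
  | nil => exact killers_nil V
  | cons a S ih =>
    rw [List.all_cons, Bool.and_eq_true] at h
    obtain ⟨ℓ, N⟩ := a
    cases ℓ with
    | zero => exact absurd h.1 (by simp [killerB])
    | succ ℓ =>
      have h1 := h.1
      simp only [killerB, goodPrimeB, Bool.and_eq_true, decide_eq_true_eq, beq_iff_eq] at h1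
      haveI : Fact (ℓ + 1).Prime := ⟨h1.1.1⟩
      exact killers_cons V h1.1.2 h1.2 (ih h.2)

/-- Residue data of a rational point at `q` (Boolean): `q` prime to both denominators and
`(m, n) ≡ (x, y) (mod q)`. [cite: SilvermanAEC2009, VII.2] -/
def residueB (q : ℕ) (x y : ℚ) (m n : ℤ) : Bool :=
  decide (¬ q ∣ x.den) && decide (¬ q ∣ y.den) &&
    decide ((q : ℤ) ∣ x.num - m * x.den) && decide ((q : ℤ) ∣ y.num - n * y.den)

/-- Doubling witness (Boolean): `q` a good prime and the residue abscissa `m` double-free in `Ẽ(𝔽_q)`.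
[cite: SilvermanAEC2009, III.2.3] -/
def dblWitnessB : ℕ → ℤ → Bool
  | 0, _ => false
  | q + 1, m => goodPrimeB V (q + 1) && xDoubleFree V (q + 1) (m : ZMod (q + 1))

/-- Coset witness (Boolean): `q` a good prime and the residue point `(m, n)` outside `2Ẽ(𝔽_q) + Ẽ(𝔽_q)[2]`.
[cite: SilvermanAEC2009, III.2.3] -/
def cosWitnessB : ℕ → ℤ → ℤ → Bool
  | 0, _, _ => false
  | q + 1, m, n =>
    goodPrimeB V (q + 1) && xCosetFree V (q + 1) (m : ZMod (q + 1)) (n : ZMod (q + 1))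

/-- No element of order `4` at a good odd prime (Boolean). [cite: SilvermanAEC2009, VII.3.1(b)] -/
def noOrder4B : ℕ → Bool
  | 0 => false
  | q + 1 => goodPrimeB V (q + 1) && decide (q + 1 ≠ 2) && noOrder4 V (q + 1)

end Checks

/-- Certificate DATA for `2 ≤ rank_ℤ E(ℚ)`: two rational points, their sum, kernel-count killers,
the torsion annihilator, three witness primes and the residues of the three points.
[cite: CremonaAlgorithms1997, §3.5] -/
structure RatCert where
  /-- `x(P₁)` -/
  x₁ : ℚ
  /-- `y(P₁)` -/
  y₁ : ℚ
  /-- `x(P₂)` -/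
  x₂ : ℚ
  /-- `y(P₂)` -/
  y₂ : ℚ
  /-- `x(P₁ + P₂)` -/
  x₃ : ℚ
  /-- `y(P₁ + P₂)` -/
  y₃ : ℚ
  /-- killers `(ℓ, #Ẽ(𝔽_ℓ))` -/
  S : List (ℕ × ℕ)
  /-- torsion annihilator -/
  t : ℕ
  /-- witness prime for `P₁` -/
  q₁ : ℕ
  /-- witness prime for `P₂` -/
  q₂ : ℕ
  /-- witness prime for `P₁ + P₂` -/
  q₃ : ℕ
  /-- `x(P₁) mod q₁` -/
  m₁ : ℤ
  /-- `y(P₁) mod q₁` -/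
  n₁ : ℤ
  /-- `x(P₂) mod q₂` -/
  m₂ : ℤ
  /-- `y(P₂) mod q₂` -/
  n₂ : ℤ
  /-- `x(P₁+P₂) mod q₃` -/
  m₃ : ℤ
  /-- `y(P₁+P₂) mod q₃` -/
  n₃ : ℤ

namespace RatCert

variable (V : WeierstrassCurve ℤ) (c : RatCert)

/-- The shape-independent checks: points on the curve, exact chord, killers, annihilator, residues. -/
def base : Bool :=
  onCurveQ V c.x₁ c.y₁ && onCurveQ V c.x₂ c.y₂ && onCurveQ V c.x₃ c.y₃ &&
    ratChord V c.x₁ c.y₁ c.x₂ c.y₂ c.x₃ c.y₃ && c.S.all (killerB V) && annihilatorCheck c.S c.t &&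
    residueB c.q₁ c.x₁ c.y₁ c.m₁ c.n₁ && residueB c.q₂ c.x₂ c.y₂ c.m₂ c.n₂ &&
    residueB c.q₃ c.x₃ c.y₃ c.m₃ c.n₃

/-- Check for shape `odd` (`t` odd, doubling witnesses): the hypotheses of
`two_le_mordellWeilRank_of_ratCert`. -/
def checkOdd : Bool :=
  c.base V && (c.t % 2 == 1) && dblWitnessB V c.q₁ c.m₁ && dblWitnessB V c.q₂ c.m₂ &&
    dblWitnessB V c.q₃ c.m₃

/-- Check for shape `two` (`t ≡ 2 mod 4`, coset witnesses): the hypotheses of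
`two_le_mordellWeilRank_of_ratCert₂`. -/
def checkTwo : Bool :=
  c.base V && (c.t % 4 == 2) && cosWitnessB V c.q₁ c.m₁ c.n₁ && cosWitnessB V c.q₂ c.m₂ c.n₂ &&
    cosWitnessB V c.q₃ c.m₃ c.n₃

/-- Check for shape `four` (`t = 2^e·m`, `m` odd, no order-`4` element at `q₀`, coset witnesses): the
hypotheses of `two_le_mordellWeilRank_of_ratCert₄`. -/
def checkFour (e m q₀ : ℕ) : Bool :=
  c.base V && (c.t == 2 ^ e * m) && (m % 2 == 1) && noOrder4B V q₀ &&
    cosWitnessB V c.q₁ c.m₁ c.n₁ && cosWitnessB V c.q₂ c.m₂ c.n₂ && cosWitnessB V c.q₃ c.m₃ c.n₃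

/-- Soundness, shape `odd`. [cite: SilvermanAEC2009, Thm. VIII.6.7] [cite: CremonaAlgorithms1997, §3.5] -/
theorem two_le_of_checkOdd (h : c.checkOdd V = true) :
    2 ≤ (V.map (Int.castRingHom ℚ)).mordellWeilRank := by
  obtain ⟨x₁, y₁, x₂, y₂, x₃, y₃, S, t, q₁, q₂, q₃, m₁, n₁, m₂, n₂, m₃, n₃⟩ := c
  simp only [checkOdd, base, Bool.and_eq_true, beq_iff_eq] at h
  obtain ⟨⟨⟨⟨⟨⟨⟨⟨⟨⟨⟨⟨h₁, h₂⟩, h₃⟩, hc⟩, hS⟩, ht⟩, hr₁⟩, hr₂⟩, hr₃⟩, hodd⟩, hw₁⟩, hw₂⟩, hw₃⟩ := h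
  simp only [residueB, Bool.and_eq_true, decide_eq_true_eq] at hr₁ hr₂ hr₃
  cases q₁ with
  | zero => simp [dblWitnessB] at hw₁
  | succ q₁ =>
  cases q₂ with
  | zero => simp [dblWitnessB] at hw₂
  | succ q₂ =>
  cases q₃ with
  | zero => simp [dblWitnessB] at hw₃
  | succ q₃ =>
  simp only [dblWitnessB, goodPrimeB, Bool.and_eq_true, decide_eq_true_eq] at hw₁ hw₂ hw₃
  haveI : Fact (q₁ + 1).Prime := ⟨hw₁.1.1⟩
  haveI : Fact (q₂ + 1).Prime := ⟨hw₂.1.1⟩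
  haveI : Fact (q₃ + 1).Prime := ⟨hw₃.1.1⟩
  exact two_le_mordellWeilRank_of_ratCert V (onCurveQ_spec V h₁) (onCurveQ_spec V h₂)
    (onCurveQ_spec V h₃) hc hodd (killers_of_all_killerB V hS) ht (q₁ + 1) (q₂ + 1) (q₃ + 1)
    hw₁.1.2 hw₂.1.2 hw₃.1.2 hr₁.1.1 hr₂.1.1 hr₃.1.1 m₁ n₁ m₂ n₂ m₃ n₃ ⟨hr₁.1.2, hr₁.2⟩
    ⟨hr₂.1.2, hr₂.2⟩ ⟨hr₃.1.2, hr₃.2⟩ hw₁.2 hw₂.2 hw₃.2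

/-- Soundness, shape `two`. [cite: SilvermanAEC2009, Thm. VIII.6.7] [cite: CremonaAlgorithms1997, §3.5] -/
theorem two_le_of_checkTwo (h : c.checkTwo V = true) :
    2 ≤ (V.map (Int.castRingHom ℚ)).mordellWeilRank := by
  obtain ⟨x₁, y₁, x₂, y₂, x₃, y₃, S, t, q₁, q₂, q₃, m₁, n₁, m₂, n₂, m₃, n₃⟩ := c
  simp only [checkTwo, base, Bool.and_eq_true, beq_iff_eq] at h
  obtain ⟨⟨⟨⟨⟨⟨⟨⟨⟨⟨⟨⟨h₁, h₂⟩, h₃⟩, hc⟩, hS⟩, ht⟩, hr₁⟩, hr₂⟩, hr₃⟩, ht2⟩, hw₁⟩, hw₂⟩, hw₃⟩ := h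
  simp only [residueB, Bool.and_eq_true, decide_eq_true_eq] at hr₁ hr₂ hr₃
  cases q₁ with
  | zero => simp [cosWitnessB] at hw₁
  | succ q₁ =>
  cases q₂ with
  | zero => simp [cosWitnessB] at hw₂
  | succ q₂ =>
  cases q₃ with
  | zero => simp [cosWitnessB] at hw₃
  | succ q₃ =>
  simp only [cosWitnessB, goodPrimeB, Bool.and_eq_true, decide_eq_true_eq] at hw₁ hw₂ hw₃
  haveI : Fact (q₁ + 1).Prime := ⟨hw₁.1.1⟩
  haveI : Fact (q₂ + 1).Prime := ⟨hw₂.1.1⟩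
  haveI : Fact (q₃ + 1).Prime := ⟨hw₃.1.1⟩
  exact two_le_mordellWeilRank_of_ratCert₂ V (onCurveQ_spec V h₁) (onCurveQ_spec V h₂)
    (onCurveQ_spec V h₃) hc ht2 (killers_of_all_killerB V hS) ht (q₁ + 1) (q₂ + 1) (q₃ + 1)
    hw₁.1.2 hw₂.1.2 hw₃.1.2 hr₁.1.1 hr₂.1.1 hr₃.1.1 m₁ n₁ m₂ n₂ m₃ n₃ ⟨hr₁.1.2, hr₁.2⟩
    ⟨hr₂.1.2, hr₂.2⟩ ⟨hr₃.1.2, hr₃.2⟩ hw₁.2 hw₂.2 hw₃.2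

/-- Soundness, shape `four`. [cite: SilvermanAEC2009, Thm. VIII.6.7] [cite: CremonaAlgorithms1997, §3.5] -/
theorem two_le_of_checkFour {e m q₀ : ℕ} (h : c.checkFour V e m q₀ = true) :
    2 ≤ (V.map (Int.castRingHom ℚ)).mordellWeilRank := by
  obtain ⟨x₁, y₁, x₂, y₂, x₃, y₃, S, t, q₁, q₂, q₃, m₁, n₁, m₂, n₂, m₃, n₃⟩ := c
  simp only [checkFour, base, Bool.and_eq_true, beq_iff_eq] at h
  obtain ⟨⟨⟨⟨⟨⟨⟨⟨⟨⟨⟨⟨⟨⟨h₁, h₂⟩, h₃⟩, hc⟩, hS⟩, ht⟩, hr₁⟩, hr₂⟩, hr₃⟩, hte⟩, hmo⟩, h4⟩, hw₁⟩,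
    hw₂⟩, hw₃⟩ := h
  simp only [residueB, Bool.and_eq_true, decide_eq_true_eq] at hr₁ hr₂ hr₃
  cases q₀ with
  | zero => simp [noOrder4B] at h4
  | succ q₀ =>
  cases q₁ with
  | zero => simp [cosWitnessB] at hw₁
  | succ q₁ =>
  cases q₂ with
  | zero => simp [cosWitnessB] at hw₂
  | succ q₂ =>
  cases q₃ with
  | zero => simp [cosWitnessB] at hw₃
  | succ q₃ =>
  simp only [cosWitnessB, goodPrimeB, Bool.and_eq_true, decide_eq_true_eq] at hw₁ hw₂ hw₃
  simp only [noOrder4B, goodPrimeB, Bool.and_eq_true, decide_eq_true_eq] at h4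
  haveI : Fact (q₀ + 1).Prime := ⟨h4.1.1.1⟩
  haveI : Fact (q₁ + 1).Prime := ⟨hw₁.1.1⟩
  haveI : Fact (q₂ + 1).Prime := ⟨hw₂.1.1⟩
  haveI : Fact (q₃ + 1).Prime := ⟨hw₃.1.1⟩
  exact two_le_mordellWeilRank_of_ratCert₄ V (onCurveQ_spec V h₁) (onCurveQ_spec V h₂)
    (onCurveQ_spec V h₃) hc (killers_of_all_killerB V hS) ht e m hte hmo (q₀ + 1) h4.1.1.2 h4.1.2
    h4.2 (q₁ + 1) (q₂ + 1) (q₃ + 1) hw₁.1.2 hw₂.1.2 hw₃.1.2 hr₁.1.1 hr₂.1.1 hr₃.1.1 m₁ n₁ m₂ n₂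
    m₃ n₃ ⟨hr₁.1.2, hr₁.2⟩ ⟨hr₂.1.2, hr₂.2⟩ ⟨hr₃.1.2, hr₃.2⟩ hw₁.2 hw₂.2 hw₃.2

end RatCert

/-- The three certificate shapes. [cite: CremonaAlgorithms1997, §3.5] -/
inductive Cert where
  /-- `t` odd; doubling witnesses (`two_le_mordellWeilRank_of_ratCert`) -/
  | odd (c : RatCert)
  /-- `t ≡ 2 (mod 4)`; coset witnesses (`two_le_mordellWeilRank_of_ratCert₂`) -/
  | two (c : RatCert)
  /-- `t = 2^e·m`, `m` odd, no order-`4` element of `Ẽ(𝔽_{q₀})`; coset witnesses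
  (`two_le_mordellWeilRank_of_ratCert₄`) -/
  | four (c : RatCert) (e m q₀ : ℕ)

/-- The certificate check (Boolean, evaluated by `decide +kernel`). -/
def Cert.check (V : WeierstrassCurve ℤ) : Cert → Bool
  | .odd c => c.checkOdd V
  | .two c => c.checkTwo V
  | .four c e m q₀ => c.checkFour V e m q₀

/-- **Soundness of the certificate check**: `c.check V = true → 2 ≤ rank_ℤ E_V(ℚ)`.
[cite: SilvermanAEC2009, Thm. VIII.6.7] [cite: CremonaAlgorithms1997, §3.5] -/
theorem two_le_mordellWeilRank_of_certCheck (V : WeierstrassCurve ℤ) :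
    ∀ c : Cert, c.check V = true → 2 ≤ (V.map (Int.castRingHom ℚ)).mordellWeilRank
  | .odd c, h => c.two_le_of_checkOdd V h
  | .two c, h => c.two_le_of_checkTwo V h
  | .four c _ _ _, h => c.two_le_of_checkFour V h

/-- The integral model `[a₁,a₂,a₃,a₄,a₆]` of a census row. [cite: CremonaAlgorithms1997, Table 1] -/
def Rank2Row.intModel (r : Rank2Row) : WeierstrassCurve ℤ := ⟨r.a₁, r.a₂, r.a₃, r.a₄, r.a₆⟩

/-- The census curve of a row is the base change of its integral model. -/
theorem Rank2Row.curve_eq_map_intModel (r : Rank2Row) :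
    r.curve = r.intModel.map (Int.castRingHom ℚ) := by
  ext <;> simp [Rank2Row.curve, Rank2Row.intModel, WeierstrassCurve.map]

/-- Row-level check: the certificate checks against the row's own integral model. -/
def certRowCheck (p : Rank2Row × Cert) : Bool :=
  p.2.check p.1.intModel

/-- **The walker.** If every (row, certificate) pair of `L` checks, every row of `L` has
`2 ≤ rank_ℤ E(ℚ)` — no hypothesis. [cite: SilvermanAEC2009, Thm. VIII.6.7]
[cite: CremonaAlgorithms1997, Table 1, §3.5] -/
theorem two_le_mordellWeilRank_of_all_certRowCheck {L : List (Rank2Row × Cert)}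
    (h : L.all certRowCheck = true) : ∀ r ∈ L.map Prod.fst, 2 ≤ r.curve.mordellWeilRank := by
  intro r hr
  obtain ⟨p, hp, rfl⟩ := List.mem_map.mp hr
  rw [Rank2Row.curve_eq_map_intModel]
  exact two_le_mordellWeilRank_of_certCheck _ _ (List.all_eq_true.mp h p hp)

end Summit.BirchSwinnertonDyer.BirchSwinnertonDyer.Rank2Observatory
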